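import Summits.Ventures.YMGap.SlabAreaLaw
import Literature.MathematicalPhysics.QuantumFieldTheory.Balaban1983to89.StrongCouplingKernelWindow
import HarnessLib

/-!
# Venture YMGap, track (a) / A4, part 4 — consistency of the slab door with Cao–Nissim–Sheffield Thm. 1.6: with the tree's
# hypothesis-free Bakry–Émery one-link modulus the door returns exactly the printed `SU(N)` threshold β < 1/(8(d−1))

HONEST FRAMING: venture file of the cell `pub-ymgap` (QuantumFields programme). With its sibling `SlabSpecification` it formalises the
finite-volume slab σ-model used by Durhuus–Fröhlich (CMP 75 (1980)) and by Cao–Nissim–Sheffield (arXiv:2509.04688, Def. 2.1,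
Thm. 2.3) to derive the Wilson AREA LAW at strong coupling, and proves the «Dobrushin door» for it: a one-link
Kantorovich–Rubinstein modulus (the tree's named hypothesis `OneLinkKRModulus N R K`, decided off-kernel for
`SU(2)`) with `2(d-1)|β| K < 1` gives covariance decay of single-site bounded Lipschitz observables, UNIFORM in
the boundary fields and the volume.  Strong-coupling LATTICE statement only; no continuum limit, no mass-gap or
Clay claim; the area-law conclusion is drawn HERE modulo the printed Durhuus–Fröhlich/CNS criterion, taken as the tree's named
Literature fact `durhuusFrohlich_areaLaw_of_slabClustering d N` (an explicit hypothesis of every area-law theorem below).  Specification of the task: `HOME/p2/SLAB-DOOR.md`.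

Model (CNS25 Def. 2.1, 't Hooft scaling): slice `Λ = (ℤ/L)^n` (`n = d-1`), spins `Q_x ∈ SU(N)`, positively
oriented edges `e = (x, i)` from `x` to `x + e_i`, boundary fields `A_e, B_e ∈ U(N)`,
`S_{A,B}(Q) = N β ∑_e Re tr(Q_x A_e Q_{x+e_i}⁻¹ B_e⁻¹)`, `μ_{A,B} ∝ exp(S_{A,B}) ∏ dQ_x`.
-/

noncomputable section

open MeasureTheory Filter Topology Function ProbabilityTheory
open scoped NNReal Matrix
open Literature.Probability.LatticeModels Literature.Probability.LatticeModels.DobrushinMetric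
open Literature.MathematicalPhysics.QuantumLattice
open Literature.MathematicalPhysics.QuantumFieldTheory
open Literature.MathematicalPhysics.QuantumFieldTheory.Balaban1983to89.StrongCouplingDobrushinWindow

namespace Summit.Ventures.YMGap.Slab

variable {N : ℕ}

/-! ## Part 4 — consistency with Cao–Nissim–Sheffield Thm. 1.6: the door with the tree's hypothesis-free Bakry–Émery one-link
modulus (`oneLinkKRModulus_SU`, K = 1/(1/2 − R)) returns EXACTLY the printed `SU(N)` area-law threshold β < 1/(8(d−1)). -/

section CNS

/-- **The slab door reproduces the Cao–Nissim–Sheffield `SU(N)` area-law threshold `β < 1/(8(d−1))`** ('t Hooft units; CNS25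
Def. 1.4 / Thm. 1.6), hypothesis-free on the one-link side: the tree's Bakry–Émery modulus `OneLinkKRModulus N R (1/(1/2 − R))`
(`oneLinkKRModulus_SU`, Shen–Zhu–Zhu Lemma 4.1) on the slab ball `R = 2(d−1)β` gives the Dobrushin constant
`c = 2(d−1)β/(1/2 − 2(d−1)β) < 1 ⟺ β < 1/(8(d−1))`, hence boundary-uniform slab clustering, hence — modulo the printed
Durhuus–Fröhlich/CNS criterion (named fact) — `HasAreaLaw d (fundamentalRep (Fin N)) (Nβ)`.  This discharges the hypothesis `hgap` of
`durhuusFrohlich_areaLaw_of_slabClustering.hasAreaLaw_of_lt_cnsThreshold` (consistency check; nothing new is claimed beyond CNS Thm. 1.6).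
[cite: CaoNissimSheffield2025dynamical, Theorems 1.6 and 2.3] [cite: arXiv220412737, Lemma 4.1] -/
theorem hasAreaLaw_of_lt_cnsThreshold {d : ℕ} (h : durhuusFrohlich_areaLaw_of_slabClustering d N) (hd : 2 ≤ d) (hN : 2 ≤ N)
    {β : ℝ} (hβ0 : 0 ≤ β) (hβ : β < 1 / (8 * ((d : ℝ) - 1))) :
    HasAreaLaw d (fundamentalRep (Fin N)) ((N : ℝ) * β) := by
  have hd1 : (0 : ℝ) < (d : ℝ) - 1 := by
    have : (2 : ℝ) ≤ d := by exact_mod_cast hd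
    linarith
  set R : ℝ := β * (2 * ((d : ℝ) - 1)) with hR
  have hR0 : 0 ≤ R := by positivity
  -- β < 1/(8(d-1))  ⇒  R = 2(d-1)β < 1/4
  have hR4 : R < 1 / 4 := by
    rw [hR]
    have h8 : 0 < 8 * ((d : ℝ) - 1) := by positivity
    have := (lt_div_iff₀ h8).1 hβ
    nlinarith
  have hRhalf : R < 1 / 2 := by linarith
  have hK0 : 0 ≤ 1 / (1 / 2 - R) := by
    have : 0 < 1 / 2 - R := by linarith
    positivity
  have hmod := Balaban1983to89.StrongCouplingKernelWindow.oneLinkKRModulus_SU hN hRhalf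
  refine hasAreaLaw_of_oneLinkKRModulus h hd hN hβ0 hK0 (le_of_eq hR.symm) hmod ?_
  -- c = 2(d-1) β K = R / (1/2 - R) < 1  since R < 1/4
  have hpos : 0 < 1 / 2 - R := by linarith
  have hc : 2 * ((d : ℝ) - 1) * β * (1 / (1 / 2 - R)) = R / (1 / 2 - R) := by rw [hR]; ring
  rw [hc, div_lt_one hpos]
  linarith

/-- `SU(2)`, Wilson units: the Bakry–Émery leg of the door gives the area law for `0 ≤ β_W < 1/6` in `d = 4` (= CNS25 Thm. 1.6 for
`SU(2)`; compare `su2_hasAreaLaw_lt_twoSevenths`: β_W < 2/7 with the quarter-modulus certificate).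
[cite: CaoNissimSheffield2025dynamical, Theorem 1.6] -/
theorem su2_hasAreaLaw_lt_oneSixth (h : durhuusFrohlich_areaLaw_of_slabClustering 4 2) {βW : ℝ} (hβ : 0 ≤ βW)
    (hlt : βW < 1 / 6) : HasAreaLaw 4 (fundamentalRep (Fin 2)) (βW / 2) := by
  have h2 : ((2 : ℕ) : ℝ) * (βW / 4) = βW / 2 := by push_cast; ring
  rw [← h2]
  exact hasAreaLaw_of_lt_cnsThreshold h (by norm_num) le_rfl (by positivity) (by push_cast; linarith)

end CNS

end Summit.Ventures.YMGap.Slab
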